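import Summits.Ventures.CertifiedManyBodySolver.Certificates.HubbardSquare_n7o8_boxface_tp0_UxN_pieces_anyAnchor_r426_r450_r472_r488_obsA0p
import Summits.Ventures.CertifiedManyBodySolver.Certificates.HubbardSquare_n7o8_boxface_tp0_UxN_pieces_r513
import HarnessLib

/-!
# LAYER-0 ENERGY FACE `F(0)` — FLOOR PIECES PARAMETRIC IN **BOTH** `n = 7/8` ANCHORS: any lower `ℓ₄` at `(4, 7/8, 0)` and any lower `ℓ` at `(8, 7/8, 0)`

Crew hubbard-fast (D-0042), seat `hubbard-box-eng-1` g7 (MO-S2 (i) POINTS → BOXES; lane = the `U × n` faces). The seat-g3 kit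
`HubbardSquare_n7o8_boxface_tp0_UxN_pieces_anyAnchor_r426_r450_r472_r488_obsA0p` made the `(8, 7/8, 0)` lower a PARAMETER `ℓ` (so CERTIFIED
#473 → #505 → #513 «T•1» were one-line re-keys) but kept the `U = 4` end of the `U`-chord pinned to the CERTIFIED #426 node. A successor row at
`(4, 7/8, 0)` is in flight (sr-mbsolver r208: «B-P2» = the P2-class word program at `U := 4`, hubbard-algo-eng-5; readers A/B, ref-3 lineage;
reader B ACCEPT 2026-08-27T08:46Z: `−327366541277305701986689/302231454903657293676544 ≈ −1.0832` vs #426 `≈ −1.1026`). This file is the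
TWO-ANCHOR generalisation, so that row (or any later one at either anchor) re-keys the `t′ = 0` face in one line per quadrant:

* `n78_lower_Ule8_of2` — the `U`-chord on `4 < U ≤ 8` from ANY `ℓ₄ ≤ e₀(1,0,4,7/8)` and ANY `ℓ ≤ e₀(1,0,8,7/8)` (concavity in `U`,
  `energyDensityTT'_chord_le`): `((8 − U)ℓ₄ + (U − 4)ℓ)/4 ≤ e₀(1, 0, U, 7/8)`;
* `faceTp0_Q1_lower_of2` (`4 < U ≤ 8`, `0 ≤ n ≤ 7/8`: leftward extrapolation through the `n = 1` cap #472),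
  `faceTp0_Q3_lower_of2` (`7/8 ≤ n < 2`: rightward through the `n = 4/5` cap #452 = #450 ∧ #354), `faceTp0_Q3v_lower_of2` (rightward through the
  vacuum `e₀(n = 0) ≤ 0`) — verbatim the kit's quadrant floors with `ℓ₄` in place of the #426 literal (convexity in `n`,
  `energyDensityTT'_ge_density_extrapolate_left/right`). The `U ≥ 8` quadrants (`faceTp0_Q2/Q4_lower_of`) do not involve the `U = 4` anchor and are
  used from the kit unchanged.
* §2 (remark): at `ℓ₄ := ℓ₄₂₆` (`r426_real h426`) these are the kit's #426-pinned lemmas verbatim (not re-declared).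

INPUTS BY NODE (hypotheses, nothing asserted): #472 (Q1), #450 ∧ #354 (Q3); the two anchors enter as real inequalities. No new number here —
a re-keying device. HONEST FRAMING: first certified bounds; not a superconductivity verdict; energy-face transport only; no phase sentence.

References: D. Ruelle, *Statistical Mechanics* (1969), §3.3–3.4 (concavity of the ground-state energy in the couplings; convexity in the
density) [cite: Ruelle1969, §3.3]; T. Koma, H. Tasaki, J. Stat. Phys. 76 (1994) 745, §1 [cite: KomaTasaki1994, §1].
-/

noncomputable section

namespace Summit.Ventures.CertifiedManyBodySolver.Certificates.BoxWordTp0UxN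

open Literature.MathematicalPhysics.QuantumLattice
open Literature.MathematicalPhysics.QuantumLattice.ThermodynamicLimit
open Summit.Ventures.CertifiedManyBodySolver
open Summit.Ventures.CertifiedManyBodySolver.Certificates

/-! ### §1 Two-anchor floor pieces -/

/-- **LOWER on the `n = 7/8` line, `4 < U ≤ 8`, from ANY two anchors**: `ℓ₄ ≤ e₀(1,0,4,7/8)` and `ℓ ≤ e₀(1,0,8,7/8)` give the `U`-chord
`((8 − U)·ℓ₄ + (U − 4)·ℓ)/4 ≤ e₀(1, 0, U, 7/8)` (concavity of `U ↦ e₀` at fixed density). [cite: Ruelle1969, §3.3] -/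
theorem n78_lower_Ule8_of2 {ℓ₄ ℓ : ℝ} (h4 : ℓ₄ ≤ energyDensityTT' 1 0 4 (7/8)) (hℓ : ℓ ≤ energyDensityTT' 1 0 8 (7/8))
    {U : ℝ} (hU4 : 4 < U) (hU8 : U ≤ 8) :
    ((8 - U) * ℓ₄ + (U - 4) * ℓ) / 4 ≤ energyDensityTT' 1 0 U (7/8) := by
  rcases lt_or_eq_of_le hU8 with hlt | heq
  · have key := energyDensityTT'_chord_le 1 0 (n := 7/8) (by norm_num) (by norm_num)
      (U₁ := 4) (U := U) (U₂ := 8) (by norm_num) hU4 hlt h4 hℓ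
    refine le_trans (le_of_eq ?_) key
    ring
  · subst heq
    refine le_trans (le_of_eq ?_) hℓ
    ring

/-- **Quadrant Q1 FLOOR, two anchors: `4 < U ≤ 8`, `0 ≤ n ≤ 7/8`** — the chord through `(1, #472 cap)` and `(7/8, U-chord of (ℓ₄, ℓ))` extended
to the left (convexity in `n`). [cite: Ruelle1969, §3.3] -/
theorem faceTp0_Q1_lower_of2 {ℓ₄ ℓ : ℝ} (h4 : ℓ₄ ≤ energyDensityTT' 1 0 4 (7/8)) (hℓ : ℓ ≤ energyDensityTT' 1 0 8 (7/8))
    (h472 : cert_r472_pb2_tl_upper_n1_U8)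
    {U n : ℝ} (hU4 : 4 < U) (hU8 : U ≤ 8) (hn0 : 0 ≤ n) (hn : n ≤ 7/8) :
    ((8 - U) * ℓ₄ + (U - 4) * ℓ) / 4 +
        (((8 - U) * ℓ₄ + (U - 4) * ℓ) / 4 - (-4475209735223/8796093022208 : ℝ)) * (7/8 - n) / (1 - 7/8)
      ≤ energyDensityTT' 1 0 U n := by
  have hU0 : 0 < U := lt_trans (by norm_num) hU4
  have hlo := n78_lower_Ule8_of2 h4 hℓ hU4 hU8
  have h1 := n1_upper_Ule8 h472 hU0.le hU8
  rcases lt_or_eq_of_le hn with hlt | heq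
  · exact energyDensityTT'_ge_density_extrapolate_left 1 0 hU0.le (n₀ := 1) (n₁ := 7/8) (n := n)
      hn0 hlt (by norm_num) (by norm_num) h1 hlo
  · subst heq
    refine le_trans (le_of_eq ?_) hlo
    ring

/-- **Quadrant Q3 FLOOR (via the `n = 4/5` cap), two anchors: `4 < U ≤ 8`, `7/8 ≤ n < 2`** — the chord through `(4/5, u₄₅₂ = #450 ∧ #354 cap line)`
and `(7/8, U-chord of (ℓ₄, ℓ))` extended to the right. [cite: Ruelle1969, §3.3] -/
theorem faceTp0_Q3_lower_of2 {ℓ₄ ℓ : ℝ} (h4 : ℓ₄ ≤ energyDensityTT' 1 0 4 (7/8)) (hℓ : ℓ ≤ energyDensityTT' 1 0 8 (7/8))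
    (h450 : cert_r450_openbox_32x4_U8_N96_tp0_D1400_b2) (h354 : cert_dbt299pair_allk)
    {U n : ℝ} (hU4 : 4 < U) (hU8 : U ≤ 8) (hn : 7/8 ≤ n) (hn2 : n < 2) :
    ((8 - U) * ℓ₄ + (U - 4) * ℓ) / 4 +
        (((8 - U) * ℓ₄ + (U - 4) * ℓ) / 4 - (-141243879594149/175921860444160 : ℝ)) * (n - 7/8) / (7/8 - 4/5)
      ≤ energyDensityTT' 1 0 U n := by
  have hU0 : 0 < U := lt_trans (by norm_num) hU4
  have hlo := n78_lower_Ule8_of2 h4 hℓ hU4 hU8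
  have h45 := n45_upper_Ule8 h450 h354 hU0.le hU8
  rcases lt_or_eq_of_le hn with hlt | heq
  · exact energyDensityTT'_ge_density_extrapolate_right 1 0 hU0.le (n₀ := 4/5) (n₁ := 7/8) (n := n)
      (by norm_num) (by norm_num) hlt hn2 h45 hlo
  · subst heq
    refine le_trans (le_of_eq ?_) hlo
    ring

/-- **Quadrant Q3 FLOOR (vacuum-anchored), two anchors: `4 < U ≤ 8`, `7/8 ≤ n < 2`** — `(8n/7)·(U-chord of (ℓ₄, ℓ))` (`e₀(n = 0) ≤ 0`,
convexity in `n`). [cite: Ruelle1969, §3.3] -/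
theorem faceTp0_Q3v_lower_of2 {ℓ₄ ℓ : ℝ} (h4 : ℓ₄ ≤ energyDensityTT' 1 0 4 (7/8)) (hℓ : ℓ ≤ energyDensityTT' 1 0 8 (7/8))
    {U n : ℝ} (hU4 : 4 < U) (hU8 : U ≤ 8) (hn : 7/8 ≤ n) (hn2 : n < 2) :
    ((8 - U) * ℓ₄ + (U - 4) * ℓ) / 4 +
        (((8 - U) * ℓ₄ + (U - 4) * ℓ) / 4 - 0) * (n - 7/8) / (7/8 - 0)
      ≤ energyDensityTT' 1 0 U n := by
  have hU0 : 0 < U := lt_trans (by norm_num) hU4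
  have hlo := n78_lower_Ule8_of2 h4 hℓ hU4 hU8
  have hz := energyDensityTT'_density_zero_le 1 0 hU0.le
  rcases lt_or_eq_of_le hn with hlt | heq
  · exact energyDensityTT'_ge_density_extrapolate_right 1 0 hU0.le (n₀ := 0) (n₁ := 7/8) (n := n)
      le_rfl (by norm_num) hlt hn2 hz hlo
  · subst heq
    refine le_trans (le_of_eq ?_) hlo
    ring

/-! ### §2 Consistency (remark, not restated): `n78_lower_Ule8_of2 (r426_real h426) hℓ` is the kit's `n78_lower_Ule8_of h426 hℓ`, and with
`hℓ := r513_real h513` it is `n78_lower_Ule8_r513` of the #513 pieces file — identical statements (the gate's dedup check confirms), so they are CITED, not re-declared. -/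

end Summit.Ventures.CertifiedManyBodySolver.Certificates.BoxWordTp0UxN

end
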